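import Literature.NumberTheory.EllipticCurves.TateCurve.RankOneTorsionSubgroups
import HarnessLib

/-!
# [GenEll] Lemma 3.2 (ii) for the Tate curve: the quotient by `𝔽_l(1) = μ_l` has Tate parameter `q^l`

S. Mochizuki, *Arithmetic elliptic curves in general position*, Math. J. Okayama Univ. **52** (2010)
[MochizukiGenEll2010], §3, journal p. 17 (kurims p. 15), read on the page (setting as in the companion file
`RankOneTorsionSubgroups.lean`: `E_K = E_q` a Tate curve over a `p`-adic field, `M_l(E)` its mod-`l` Tate
module, `0 → 𝔽_l(1) → M_l(E) → 𝔽_l → 0`):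

> **Lemma 3.2** "(ii) The submodule `𝔽_l(1) ⊆ M_l(E)` of the above exact sequence defines a finite, flat
> subgroup scheme `μ_l ⊆ E` over `O_K`, whose quotient we denote by `E′ = E/μ_l`. [Thus, `E′ → Spec(O_K)`
> is a one-dimensional semi-abelian scheme over `O_K` whose generic fiber is proper, and whose special
> fiber is isomorphic to `(𝔾_m)_k`.] The Tate parameter `q_{E′}` of `E′` satisfies the relation
> `q_{E′} = q_E^l`; in particular, we have `deg_∞(E′) = l·deg_∞(E)` — where we write
> `deg_∞(E) = log(#(O_K/(q_E))) ∈ ℝ`."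

DAG node `GenEll:Lem3.2(ii)` (abc-iut cell, layer S). What is PROVED here (theorems only; no
definition, no named fact, nothing conditional), AT THE LEVEL OF `K̄`-POINTS WITH THEIR GALOIS ACTION:

* `exists_eq_zsmul_add_of_nsmul_eq_zero`, `exists_smul_generator_eq_add` — the natural exact sequence
  itself for a `q^ℤ`-uniformisation `φ : K̄^× ↠ M` ([GenEll] §3, journal p. 17, citing [FC] III Cor. 7.3):
  `M[l]` is spanned by `𝔽_l(1) = φ(μ_l)` and the class of `φ(q^{1/l})`, and `G_K` moves `φ(q^{1/l})`
  inside its `φ(μ_l)`-coset (the Kummer cocycle `σ ↦ σ(q^{1/l})/q^{1/l}`: "`𝔽_l` is equipped with the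
  trivial Galois action … the extension class … is precisely that obtained by extracting an `l`-th root
  of the Tate parameter");
* `exists_quotientMap_of_uniformizations` — for a `q^ℤ`-uniformisation `φ : K̄^× ↠ M` and a
  `(q^l)^ℤ`-uniformisation `φ' : K̄^× → M'` (kernels `q^ℤ`, `(q^l)^ℤ`, both `G_K`-equivariant), the map
  `u ↦ u^l` descends to a homomorphism `ψ : M → M'` with `ψ ∘ φ = φ' ∘ (·)^l`, surjective when `φ'` is,
  `G_K`-equivariant, with kernel EXACTLY `φ(μ_l) = 𝔽_l(1)`;
* `GenEll_lemma32_ii` — for the tree's `tateCurve q` (`K` complete ultrametric of characteristic `0`,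
  `0 < ‖q‖ < 1`, `0 < l`): with Tate's uniformisations of `E_q` and `E_{q^l}` (the tree's theorem
  `uniformization_holds`, Silverman ATAEC V.3.1 (c),(d), at `q` and at `q^l`), a SURJECTIVE `G_K`-equivariant
  `ψ : E_q(K̄) → E_{q^l}(K̄)` with `ψ(φ(u)) = φ'(u^l)` and `ker ψ = 𝔽_l(1)` of order `l` — "the quotient
  `E/μ_l` is the Tate curve with parameter `q^l`" for the Galois modules of points;
* `log_inv_norm_pow` — "`deg_∞(E′) = l·deg_∞(E)`": `log ‖q^l‖⁻¹ = l·log ‖q‖⁻¹` (Def. 3.3 reads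
  `deg_∞ = −log|q_E|` for the absolute value normalised by `|x| = #(O_K/(x))⁻¹`).

Deliberately NOT here (disclosed weaker-than-print points): Néron models / the finite flat subgroup
SCHEME `μ_l ⊆ E` over `O_K`, and the identification of the ALGEBRAIC quotient isogeny `E_q → E_q/μ_l`
(Silverman AEC III.4.12, in the tree) with an algebraic isogeny `E_q → E_{q^l}` (Vélu's formulae for the
`l`-isogeny of Tate curves): `ψ` is built from the uniformisations and its algebraicity is not asserted.
Mathlib has no Néron models; the Galois-module statement is what [GenEll] Lem. 3.5 / Thm. 3.8 consume
("`E_H` may be identified with `E′` … `deg_∞(E_H) = l·deg_∞(E)`").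

References: [MochizukiGenEll2010] §3, Lemma 3.2 (ii), Def. 3.3 (journal p. 17); [SilvermanATAEC1994]
Thm. V.3.1 (c),(d) (PDF pp. 394–399). abc-iut cell, campaign S, seat abc-iut-S-d3 (gen 3); classical,
takes no side on anything disputed.
-/

noncomputable section

open scoped Classical

namespace Literature.NumberTheory.EllipticCurves.TateCurve

open Field WeierstrassCurve SteinWuthrich2013

universe u v

section Quotient

variable {K : Type u} [Field K] {q : K}
  {M : Type v} [AddCommGroup M] [MulAction (absoluteGaloisGroup K) M]
  {M' : Type v} [AddCommGroup M'] [MulAction (absoluteGaloisGroup K) M']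


omit [MulAction (absoluteGaloisGroup K) M] in
/-- **The natural exact sequence `0 → 𝔽_l(1) → M_l(E) → 𝔽_l → 0`, generators** ([GenEll] §3, journal
p. 17, citing [FC] III Cor. 7.3: "`M_l(E)` fits into a natural exact sequence of `G_K`-modules … the
extension class … is precisely that obtained by extracting an `l`-th root of the Tate parameter"): for a
`q^ℤ`-uniformisation `φ : K̄^× ↠ M` (kernel `q^ℤ`) and an `l`-th root `w₀` of `q` in `K̄` (`0 < l`), every
`l`-torsion element of `M` is `k•φ(w₀) + φ(ζ)` with `ζ ∈ μ_l` — i.e. `M[l]` is spanned by `𝔽_l(1) = φ(μ_l)`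
and the class of `φ(q^{1/l})`. [cite: MochizukiGenEll2010, §3 Lem 3.2 p.15] -/
theorem exists_eq_zsmul_add_of_nsmul_eq_zero (hq0 : q ≠ 0)
    (φ : Additive (AlgebraicClosure K)ˣ →+ M) (hsurj : Function.Surjective φ)
    (hker : ∀ u : (AlgebraicClosure K)ˣ, φ (Additive.ofMul u) = 0 ↔
      ∃ n : ℤ, (u : AlgebraicClosure K) = algebraMap K (AlgebraicClosure K) q ^ n)
    {l : ℕ} (w₀ : (AlgebraicClosure K)ˣ)
    (hw₀ : (w₀ : AlgebraicClosure K) ^ l = algebraMap K (AlgebraicClosure K) q)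
    {P : M} (hP : l • P = 0) :
    ∃ (k : ℤ) (ζ : (AlgebraicClosure K)ˣ), ζ ^ l = 1 ∧
      P = k • φ (Additive.ofMul w₀) + φ (Additive.ofMul ζ) := by
  set Kb := AlgebraicClosure K
  set qb : Kb := algebraMap K Kb q with hqb_def
  have hqb0 : qb ≠ 0 := (_root_.map_ne_zero _).mpr hq0
  obtain ⟨a, ha⟩ := hsurj P
  obtain ⟨w, rfl⟩ : ∃ w : Kbˣ, Additive.ofMul w = a := ⟨Additive.toMul a, ofMul_toMul a⟩
  have hwl : φ (Additive.ofMul (w ^ l)) = 0 := by rw [ofMul_pow, map_nsmul, ha, hP]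
  obtain ⟨m, hm⟩ := (hker _).mp hwl
  rw [Units.val_pow_eq_pow_val] at hm
  refine ⟨m, w * w₀ ^ (-m), ?_, ?_⟩
  · ext
    rw [Units.val_pow_eq_pow_val, Units.val_mul, Units.val_zpow_eq_zpow_val, mul_pow, hm,
      ← zpow_natCast ((w₀ : Kb) ^ (-m)) l, ← zpow_mul, mul_comm (-m), zpow_mul, zpow_natCast, hw₀,
      ← zpow_add₀ hqb0, add_neg_cancel, zpow_zero, Units.val_one]
  · rw [ofMul_mul, map_add, ofMul_zpow, map_zsmul, ← ha, neg_smul]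
    abel

/-- **The quotient `M_l(E)/𝔽_l(1) ≅ 𝔽_l` has TRIVIAL `G_K`-action** (the Kummer cocycle of `q`): for a
`G_K`-equivariant `q^ℤ`-uniformisation `φ` and an `l`-th root `w₀` of `q ∈ K`, every `σ ∈ G_K` moves the
generator `φ(w₀)` of `M[l]/φ(μ_l)` by an element of `𝔽_l(1) = φ(μ_l)`: `σ•φ(w₀) = φ(w₀) + φ(σ(w₀)/w₀)` with
`(σ(w₀)/w₀)^l = σ(q)/q = 1` ([GenEll] §3, journal p. 17: "`𝔽_l` is equipped with the trivial Galois
action … the extension class … is precisely that obtained by extracting an `l`-th root of the Tate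
parameter"). [cite: MochizukiGenEll2010, §3 Lem 3.2 p.15] -/
theorem exists_smul_generator_eq_add
    (φ : Additive (AlgebraicClosure K)ˣ →+ M)
    (hequiv : ∀ (σ : absoluteGaloisGroup K) (u : (AlgebraicClosure K)ˣ),
      σ • φ (Additive.ofMul u) =
        φ (Additive.ofMul (Units.map
          (absoluteGaloisGroup.toAlgEquiv K σ : AlgebraicClosure K →* AlgebraicClosure K) u)))
    {l : ℕ} (w₀ : (AlgebraicClosure K)ˣ)
    (hw₀ : (w₀ : AlgebraicClosure K) ^ l = algebraMap K (AlgebraicClosure K) q)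
    (σ : absoluteGaloisGroup K) :
    ∃ ζ : (AlgebraicClosure K)ˣ, ζ ^ l = 1 ∧
      σ • φ (Additive.ofMul w₀) = φ (Additive.ofMul w₀) + φ (Additive.ofMul ζ) := by
  set Kb := AlgebraicClosure K
  by_cases hq0 : q = 0
  · -- degenerate case `q = 0`: a unit `w₀` with `w₀ ^ l = 0` forces `l = 0`
    rcases Nat.eq_zero_or_pos l with hl | hl
    · refine ⟨Units.map (absoluteGaloisGroup.toAlgEquiv K σ : Kb →* Kb) w₀ * w₀⁻¹, by rw [hl, pow_zero], ?_⟩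
      rw [hequiv, ofMul_mul, ofMul_inv, map_add, map_neg]
      abel
    · exfalso
      apply w₀.ne_zero
      have h0 : (w₀ : Kb) ^ l = 0 := by rw [hw₀, hq0, map_zero]
      exact (pow_eq_zero_iff hl.ne').mp h0
  refine ⟨Units.map (absoluteGaloisGroup.toAlgEquiv K σ : Kb →* Kb) w₀ * w₀⁻¹, ?_, ?_⟩
  · ext
    rw [Units.val_pow_eq_pow_val, Units.val_mul, Units.coe_map, MonoidHom.coe_coe,
      Units.val_inv_eq_inv_val, mul_pow, ← map_pow, hw₀, AlgEquiv.commutes, inv_pow, hw₀,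
      mul_inv_cancel₀ ((_root_.map_ne_zero _).mpr hq0), Units.val_one]
  · rw [hequiv, ofMul_mul, ofMul_inv, map_add, map_neg]
    abel

/-- **[GenEll] Lemma 3.2 (ii) at the level of points: the quotient by `𝔽_l(1)` is uniformised by `q^l`.**
Let `φ : K̄^× → M` be a `q^ℤ`-uniformisation (surjective, kernel `q^ℤ`, `G_K`-equivariant) and
`φ' : K̄^× → M'` a `(q^l)^ℤ`-uniformisation (kernel `(q^l)^ℤ`, `G_K`-equivariant), `0 < l`, `q ≠ 0`. Then
`u ↦ φ'(u^l)` descends along `φ` to a homomorphism `ψ : M → M'` with `ψ(φ(u)) = φ'(u^l)`, which is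
surjective as soon as `φ'` is (every element of `K̄` is an `l`-th power), has kernel EXACTLY `φ(μ_l)`
(`φ'(w^l) = 0 ⟺ w^l ∈ (q^l)^ℤ ⟺ w ∈ μ_l·q^ℤ`), and is `G_K`-equivariant. With `M = E_q(K̄)`,
`M' = E_{q^l}(K̄)` this is "`E′ = E/μ_l` has Tate parameter `q_{E′} = q_E^l`" for the Galois modules of
`K̄`-points; the algebraic isogeny `E_q → E_{q^l}` (Vélu) and the `O_K`-subgroup scheme `μ_l` are NOT
constructed here. [cite: MochizukiGenEll2010, Lem 3.2 (ii) p.15] -/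
theorem exists_quotientMap_of_uniformizations (hq0 : q ≠ 0)
    (φ : Additive (AlgebraicClosure K)ˣ →+ M) (hsurj : Function.Surjective φ)
    (hker : ∀ u : (AlgebraicClosure K)ˣ, φ (Additive.ofMul u) = 0 ↔
      ∃ n : ℤ, (u : AlgebraicClosure K) = algebraMap K (AlgebraicClosure K) q ^ n)
    (hequiv : ∀ (σ : absoluteGaloisGroup K) (u : (AlgebraicClosure K)ˣ),
      σ • φ (Additive.ofMul u) =
        φ (Additive.ofMul (Units.map
          (absoluteGaloisGroup.toAlgEquiv K σ : AlgebraicClosure K →* AlgebraicClosure K) u)))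
    {l : ℕ} (hl : 0 < l) (φ' : Additive (AlgebraicClosure K)ˣ →+ M')
    (hker' : ∀ u : (AlgebraicClosure K)ˣ, φ' (Additive.ofMul u) = 0 ↔
      ∃ n : ℤ, (u : AlgebraicClosure K) = algebraMap K (AlgebraicClosure K) (q ^ l) ^ n)
    (hequiv' : ∀ (σ : absoluteGaloisGroup K) (u : (AlgebraicClosure K)ˣ),
      σ • φ' (Additive.ofMul u) =
        φ' (Additive.ofMul (Units.map
          (absoluteGaloisGroup.toAlgEquiv K σ : AlgebraicClosure K →* AlgebraicClosure K) u))) :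
    ∃ ψ : M →+ M',
      (∀ u : (AlgebraicClosure K)ˣ, ψ (φ (Additive.ofMul u)) = φ' (Additive.ofMul (u ^ l))) ∧
      (Function.Surjective φ' → Function.Surjective ψ) ∧
      (∀ P : M, ψ P = 0 ↔
        P ∈ (fun u : (AlgebraicClosure K)ˣ => φ (Additive.ofMul u)) '' {u | u ^ l = 1}) ∧
      (∀ (σ : absoluteGaloisGroup K) (P : M), σ • ψ P = ψ (σ • P)) := by
  set Kb := AlgebraicClosure K
  set qb : Kb := algebraMap K Kb q with hqb_def
  have hqb0 : qb ≠ 0 := (_root_.map_ne_zero _).mpr hq0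
  -- the homomorphism `u ↦ φ'(u ^ l)`
  let g : Additive Kbˣ →+ M' :=
    { toFun := fun a => φ' (Additive.ofMul (Additive.toMul a ^ l))
      map_zero' := by rw [toMul_zero, one_pow, ofMul_one, map_zero]
      map_add' := fun a b => by rw [toMul_add, mul_pow, ofMul_mul, map_add] }
  have hg : ∀ u : Kbˣ, g (Additive.ofMul u) = φ' (Additive.ofMul (u ^ l)) := fun u => rfl
  -- it kills `ker φ = q^ℤ`
  have hgker : φ.ker ≤ g.ker := by
    intro a ha
    rw [AddMonoidHom.mem_ker] at ha ⊢
    have ha' : φ (Additive.ofMul (Additive.toMul a)) = 0 := by rwa [ofMul_toMul]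
    obtain ⟨n, hn⟩ := (hker _).mp ha'
    rw [← ofMul_toMul a, hg]
    refine (hker' _).mpr ⟨n, ?_⟩
    rw [Units.val_pow_eq_pow_val, hn, map_pow]
    rw [← zpow_natCast (qb ^ n) l, ← zpow_mul, ← zpow_natCast qb l, ← zpow_mul, mul_comm]
  let ψ : M →+ M' := φ.liftOfSurjective hsurj ⟨g, hgker⟩
  have hψ : ∀ u : Kbˣ, ψ (φ (Additive.ofMul u)) = φ' (Additive.ofMul (u ^ l)) := by
    intro u
    rw [← hg]
    exact φ.liftOfRightInverse_comp_apply _ _ ⟨g, hgker⟩ _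
  refine ⟨ψ, hψ, ?_, ?_, ?_⟩
  · -- surjectivity: `φ'` is onto and `K̄` is closed under `l`-th roots
    intro hsurj' P'
    obtain ⟨a, ha⟩ := hsurj' P'
    obtain ⟨z, hz⟩ := IsAlgClosed.exists_pow_nat_eq ((Additive.toMul a : Kbˣ) : Kb) hl
    have hz0 : z ≠ 0 := by
      rintro rfl
      rw [zero_pow hl.ne'] at hz
      exact (Additive.toMul a).ne_zero hz.symm
    refine ⟨φ (Additive.ofMul (Units.mk0 z hz0)), ?_⟩
    have hzl : (Units.mk0 z hz0) ^ l = Additive.toMul a := by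
      ext
      rw [Units.val_pow_eq_pow_val, Units.val_mk0, hz]
    rw [hψ, hzl, ofMul_toMul, ha]
  · -- kernel `= φ(μ_l)`
    intro P
    obtain ⟨a, ha⟩ := hsurj P
    set w : Kbˣ := Additive.toMul a with hw_def
    have hw : φ (Additive.ofMul w) = P := by simpa [hw_def] using ha
    constructor
    · intro hP0
      rw [← hw, hψ] at hP0
      obtain ⟨n, hn⟩ := (hker' _).mp hP0
      rw [Units.val_pow_eq_pow_val, map_pow] at hn
      refine ⟨w * (Units.mk0 qb hqb0) ^ (-n), ?_, ?_⟩
      · show (w * Units.mk0 qb hqb0 ^ (-n)) ^ l = 1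
        ext
        rw [Units.val_pow_eq_pow_val, Units.val_mul, Units.val_zpow_eq_zpow_val, Units.val_mk0,
          mul_pow, hn, ← zpow_natCast (qb ^ (-n)) l, ← zpow_mul, ← zpow_natCast qb l, ← zpow_mul,
          ← zpow_add₀ hqb0, Units.val_one]
        convert zpow_zero qb using 2
        ring
      · show φ (Additive.ofMul (w * Units.mk0 qb hqb0 ^ (-n))) = P
        have h1 : φ (Additive.ofMul (Units.mk0 qb hqb0)) = 0 := (hker _).mpr ⟨1, by simp⟩
        rw [ofMul_mul, map_add, hw, ofMul_zpow, map_zsmul, h1, smul_zero, add_zero]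
    · rintro ⟨ζ, hζ, hζP⟩
      have hζP' : φ (Additive.ofMul ζ) = P := hζP
      have hζ' : ζ ^ l = 1 := hζ
      rw [← hζP', hψ, hζ', ofMul_one, map_zero]
  · -- equivariance
    intro σ P
    obtain ⟨a, ha⟩ := hsurj P
    obtain ⟨w, rfl⟩ : ∃ w : Kbˣ, Additive.ofMul w = a := ⟨Additive.toMul a, ofMul_toMul a⟩
    rw [← ha, hψ, hequiv', hequiv, hψ, ← map_pow]

end Quotient

section Degree

variable {K : Type u} [NormedField K]

/-- "`deg_∞(E′) = l·deg_∞(E)`" ([GenEll] Lemma 3.2 (ii), with Def. 3.3: `deg_∞(E) = log #(O_K/(q_E))`,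
i.e. `−log|q_E|` for the absolute value normalised by `|x| = #(O_K/(x))⁻¹`): for the Tate parameter `q^l`
of the quotient, `log ‖q^l‖⁻¹ = l·log ‖q‖⁻¹` in any normed field. [cite: MochizukiGenEll2010, Lem 3.2 (ii) and Def 3.3 p.15] -/
theorem log_inv_norm_pow (q : K) (l : ℕ) : Real.log ‖q ^ l‖⁻¹ = l * Real.log ‖q‖⁻¹ := by
  rw [norm_pow, ← inv_pow, Real.log_pow]

end Degree

section TateCurve

variable {K : Type u} [NontriviallyNormedField K] [CompleteSpace K] [IsUltrametricDist K]
  [CharZero K] {q : K}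

/-- **[GenEll] Lemma 3.2 (ii) for the Tate curve, at the level of `K̄`-points**: for `K` complete ultrametric
of characteristic `0`, `0 < ‖q‖ < 1`, `0 < l`, there are Tate uniformisations `φ : K̄^× ↠ E_q(K̄)` (kernel
`q^ℤ`) and `φ' : K̄^× ↠ E_{q^l}(K̄)` (kernel `(q^l)^ℤ`), both `G_K`-equivariant (the tree's
`uniformization_holds` at `q` and at `q^l`, `‖q^l‖ < 1`), and a SURJECTIVE `G_K`-equivariant homomorphism
`ψ : E_q(K̄) → E_{q^l}(K̄)` with `ψ ∘ φ = φ' ∘ (u ↦ u^l)` whose kernel is EXACTLY `φ(μ_l) = 𝔽_l(1)`, of order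
`l`: "the quotient `E′ = E/μ_l` … has Tate parameter `q_{E′} = q_E^l`" for the Galois modules of points
(with `log_inv_norm_pow` for "`deg_∞(E′) = l·deg_∞(E)`"). The algebraic isogeny / Néron-model clauses of
(ii) are not constructed (module docstring). DAG node GenEll:Lem3.2(ii). [cite: MochizukiGenEll2010, Lem 3.2 (ii) p.15] -/
theorem GenEll_lemma32_ii (hq0 : q ≠ 0) (hq : ‖q‖ < 1) {l : ℕ} (hl : 0 < l) :
    ∃ (φ : Additive (AlgebraicClosure K)ˣ →+ geomPoints (tateCurve q))
      (φ' : Additive (AlgebraicClosure K)ˣ →+ geomPoints (tateCurve (q ^ l)))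
      (ψ : geomPoints (tateCurve q) →+ geomPoints (tateCurve (q ^ l))),
      Function.Surjective φ ∧
      (∀ u : (AlgebraicClosure K)ˣ, φ (Additive.ofMul u) = 0 ↔
        ∃ n : ℤ, (u : AlgebraicClosure K) = algebraMap K (AlgebraicClosure K) q ^ n) ∧
      (∀ (σ : absoluteGaloisGroup K) (u : (AlgebraicClosure K)ˣ),
        σ • φ (Additive.ofMul u) =
          φ (Additive.ofMul (Units.map
            (absoluteGaloisGroup.toAlgEquiv K σ : AlgebraicClosure K →* AlgebraicClosure K) u))) ∧
      Function.Surjective φ' ∧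
      (∀ u : (AlgebraicClosure K)ˣ, φ' (Additive.ofMul u) = 0 ↔
        ∃ n : ℤ, (u : AlgebraicClosure K) = algebraMap K (AlgebraicClosure K) (q ^ l) ^ n) ∧
      (∀ (σ : absoluteGaloisGroup K) (u : (AlgebraicClosure K)ˣ),
        σ • φ' (Additive.ofMul u) =
          φ' (Additive.ofMul (Units.map
            (absoluteGaloisGroup.toAlgEquiv K σ : AlgebraicClosure K →* AlgebraicClosure K) u))) ∧
      (∀ u : (AlgebraicClosure K)ˣ, ψ (φ (Additive.ofMul u)) = φ' (Additive.ofMul (u ^ l))) ∧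
      Function.Surjective ψ ∧
      (∀ P, ψ P = 0 ↔ P ∈ (fun u : (AlgebraicClosure K)ˣ => φ (Additive.ofMul u)) '' {u | u ^ l = 1}) ∧
      Nat.card ψ.ker = l ∧
      (∀ (σ : absoluteGaloisGroup K) (P : geomPoints (tateCurve q)), σ • ψ P = ψ (σ • P)) := by
  have hql0 : q ^ l ≠ 0 := pow_ne_zero _ hq0
  have hql : ‖q ^ l‖ < 1 := by
    rw [norm_pow]
    exact pow_lt_one₀ (norm_nonneg _) hq hl.ne'
  obtain ⟨φ, hsurj, hker, hequiv, -⟩ := uniformization_holds q hq0 hq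
  obtain ⟨φ', hsurj', hker', hequiv', -⟩ := uniformization_holds (q ^ l) hql0 hql
  obtain ⟨ψ, hψ, hψsurj, hψker, hψequiv⟩ :=
    exists_quotientMap_of_uniformizations hq0 φ hsurj hker hequiv hl φ' hker' hequiv'
  obtain ⟨N₀, hN₀, hcard, -⟩ := exists_subgroup_coe_eq_image_rootsOfUnity hq0 hq φ hker hequiv hl
  refine ⟨φ, φ', ψ, hsurj, hker, hequiv, hsurj', hker', hequiv', hψ, hψsurj hsurj', hψker, ?_, hψequiv⟩
  have hk : ψ.ker = N₀ := by
    ext P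
    rw [AddMonoidHom.mem_ker, hψker, ← SetLike.mem_coe, hN₀]
  rw [hk]
  exact hcard

end TateCurve

end Literature.NumberTheory.EllipticCurves.TateCurve

end
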